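import Mathlib
import Summits.Ventures.HodgeRepro.FaceCensusEngine
import Summits.Ventures.HodgeRepro.CMType
import Summits.Ventures.HodgeRepro.HodgeSets
import Summits.Ventures.HodgeRepro.CMRank
import Summits.Ventures.HodgeRepro.Primitive
import Summits.Ventures.HodgeRepro.EngineBridge

/-!
# Cayley tables of Mathlib groups (blind cell `pub-hodge-repro`, seat p2)

`ofGroup c e : CMGaloisType n` is the Cayley table of a finite group `G` with central involution `c`
along an enumeration `e : Fin n ≃ G`.  It passes the engine's `Bool` check (`isCMGaloisType_ofGroup`),
its element type `Elt (ofGroup c e)` is isomorphic to `G` as a group (`eltEquiv`), and masks correspond to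
finsets of `G` (`finsetOf_ofGroup`).  This is how a census row stated on the sealer's table of `C6`, `D6`, …
is read on the typer's `Groups.lean` types.
-/

set_option autoImplicit false

open Finset
open scoped Pointwise

namespace HodgeRepro

namespace EngineBridge

open Summit.Ventures.HodgeRepro.FaceCensus

variable {n : ℕ} {G : Type*} [Group G]

/-- The Cayley table of `(G, c)` along the enumeration `e`. -/
def ofGroup (c : G) (e : Fin n ≃ G) : CMGaloisType n where
  mul i j := e.symm (e i * e j)
  one := e.symm 1
  conj := e.symm c

/-- Multiplication in the table of `(G, c)` along `e`. -/
@[simp] theorem ofGroup_mul (c : G) (e : Fin n ≃ G) (i j : Fin n) :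
    (ofGroup c e).mul i j = e.symm (e i * e j) := rfl

/-- The identity in the table of `(G, c)` along `e`. -/
@[simp] theorem ofGroup_one (c : G) (e : Fin n ≃ G) : (ofGroup c e).one = e.symm 1 := rfl

/-- Complex conjugation in the table of `(G, c)` along `e`. -/
@[simp] theorem ofGroup_conj (c : G) (e : Fin n ≃ G) : (ofGroup c e).conj = e.symm c := rfl

/-- The table of a group with a central involution passes the engine's check. -/
theorem isCMGaloisType_ofGroup {c : G} (hc : IsComplexConj c) (e : Fin n ≃ G) :
    (ofGroup c e).isCMGaloisType = true := by
  rw [isCMGaloisType_iff]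
  refine ⟨?_, ?_, ?_, ?_, ?_, ?_⟩
  · intro i j k
    simp [mul_assoc]
  · intro i
    simp
  · intro i
    exact ⟨e.symm (e i)⁻¹, by simp⟩
  · intro i
    simp [hc.comm]
  · simp [hc.mul_self]
  · intro h
    apply hc.ne_one
    simpa using h

/-- The table of a group with a complex conjugation `c` passes the engine's check, as a `Fact` instance. -/
instance instFactOfGroup {c : G} [hc : Fact (IsComplexConj c)] (e : Fin n ≃ G) :
    Fact ((ofGroup c e).isCMGaloisType = true) :=
  ⟨isCMGaloisType_ofGroup hc.out e⟩

section Equiv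

variable (c : G) (e : Fin n ≃ G)

/-- The element type of the table is the group `G` (a multiplicative equivalence; under
`Fact (IsComplexConj c)` both sides are groups and it is a group isomorphism). -/
noncomputable def eltEquiv : Elt (ofGroup c e) ≃* G where
  toFun a := e (Elt.idx _ a)
  invFun g := Elt.ofIdx _ (e.symm g)
  left_inv a := by simp [Elt.idx, Elt.ofIdx]
  right_inv g := by simp [Elt.idx, Elt.ofIdx]
  map_mul' a b := by
    show e ((ofGroup c e).mul (Elt.idx _ a) (Elt.idx _ b)) = e (Elt.idx _ a) * e (Elt.idx _ b)
    simp

/-- `eltEquiv` unfolds to the enumeration `e`. -/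
theorem eltEquiv_apply (a : Elt (ofGroup c e)) : eltEquiv c e a = e (Elt.idx _ a) := rfl

/-- The inverse of `eltEquiv` unfolds to `e.symm`. -/
theorem eltEquiv_symm_apply (g : G) : (eltEquiv c e).symm g = Elt.ofIdx _ (e.symm g) := rfl

/-- Complex conjugation of the table corresponds to `c`. -/
theorem eltEquiv_conj : eltEquiv c e (Elt.conj (ofGroup c e)) = c := by
  simp [eltEquiv_apply, Elt.conj, Elt.idx, Elt.ofIdx]

/-- The finset of a mask, read in `G`: `{e i | bit i of T}`. -/
theorem map_finsetOf_ofGroup [Fintype G] [DecidableEq G] (T : ℕ) :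
    (finsetOf (ofGroup c e) T).map (eltEquiv c e).toEquiv.toEmbedding =
      univ.filter fun g : G => mem (e.symm g) T = true := by
  ext g
  simp only [mem_map_equiv, mem_finsetOf, mem_filter, mem_univ, true_and]
  rfl

/-- Membership in the finset of a mask, read in `G`. -/
theorem mem_finsetOf_ofGroup_iff (T : ℕ) (g : G) :
    (eltEquiv c e).symm g ∈ finsetOf (ofGroup c e) T ↔ mem (e.symm g) T = true := by
  rw [mem_finsetOf]
  rfl

end Equiv

end EngineBridge

end HodgeRepro
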